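import Literature.NumberTheory.EllipticCurves.KubertTate1314Torsion
import HarnessLib

/-!
# The Kubert–Tate curve `E_{13/14}`: the multiplicative relation attached to a linear relation
# among rational points (the `μ₅`-side of the `5`-descent, on rational points)

PROOF-ONLY file (theorems only), topic `NumberTheory/EllipticCurves`; sequel of
`KubertTate1314Torsion`, consumed by `KubertTate1314Rank`. For
`E = E_{13/14} = kubertTateFive 13 14 : y² + xy - 2548 y = x³ - 182 x²` (`T = (0,0)` of order `5`)
and the Kummer function `f_T = xy - 14x² + 196y` (`div f_T = 5(T̄) - 5(O)`, tree
`KubertTateKummer.ord_kummerFn`):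

* `exists_pow_five_mul_eq₅` — **if `e₁X₁ + … + e₅X₅ = 5Q` in `E(ℚ)` with `X_l ∉ {O, T}`, then
  `∏ f_T(X_l)^{e_l} = u⁵ · f_T(5Q₀)^{Σ e_l}` with `u ∈ ℚˣ`**, for any fixed rational `Q₀` with
  `5Q₀ ∉ {O, T}`. Proof (Silverman X.1.1(c) / Exercise 10.1(c)): Kummer elements
  `w_l = h(R_l)/h(Q₀)`, `5R_l = X_l` (tree `exists_kummerElement`: `σ w_l = e₅(σR_l - R_l, T̄) w_l`,
  `w_l⁵ f_T(5Q₀) = f_T(X_l)`); the point `R* = Σ e_l R_l - Q` is `5`-torsion and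
  `∏ e₅(σR_l - R_l, T̄)^{e_l} = e₅(σR* - R*, T̄) = σ(ζ)/ζ` with `ζ = e₅(R*, T̄)` (bilinearity and
  Galois equivariance of the tree's Weil pairing, `T̄` rational), so `∏ w_l^{e_l} / ζ` is
  `Γ_ℚ`-fixed, i.e. rational, and `ζ⁵ = 1`;
* `exists_pow_five_mul_eq` — the three-point case.

No completion, no `L`-function and no conjecture enters.

## References

* [SilvermanAEC2009] J. H. Silverman, *AEC*, 2nd ed., III.§8 (Prop. III.8.1), Thm. X.1.1(c) and its
  proof, Exercise 10.1(c).
* [Kubert1976] D. S. Kubert, *Universal bounds on the torsion of elliptic curves*, Table 3.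
-/

noncomputable section

open scoped Classical
open WeierstrassCurve Field
open Literature.NumberTheory.EllipticCurves Literature.NumberTheory.EllipticCurves.KubertTateKummer
  Literature.NumberTheory.EllipticCurves.KubertTateVelu

-- The `ℚ`-algebra diamond on `AlgebraicClosure ℚ` (`DivisionRing.toRatAlgebra` vs
-- `AlgebraicClosure.instAlgebra`): the tree's Kummer theory is keyed on the latter (same device as
-- `X1ElevenMordellWeil` and `KubertTate1314Torsion`).
attribute [-instance] DivisionRing.toRatAlgebra

namespace Literature.NumberTheory.EllipticCurves

namespace KubertTate1314Descent

/-! ## The Kummer elements and the multiplicative relation -/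

section Kummer

/-- Fixed combinations, five factors: if `σ w_l = χ_l(σ) w_l` and `∏ χ_l(σ)^{e_l} · ζ = σ ζ` with
`ζ ≠ 0`, then `∏ w_l^{e_l} / ζ = ι(u)` for some `u ∈ F` (the five-factor form of the tree's
`exists_algebraMap_eq_prod_div`). [cite: SilvermanAEC2009, Thm. X.1.1(c) (proof)] -/
theorem exists_algebraMap_eq_prod₅_div {F : Type*} [Field F] [CharZero F]
    {w₁ w₂ w₃ w₄ w₅ ζ : AlgebraicClosure F}
    {χ₁ χ₂ χ₃ χ₄ χ₅ : absoluteGaloisGroup F → AlgebraicClosure F}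
    (h₁ : ∀ σ, galRingHom σ w₁ = χ₁ σ * w₁) (h₂ : ∀ σ, galRingHom σ w₂ = χ₂ σ * w₂)
    (h₃ : ∀ σ, galRingHom σ w₃ = χ₃ σ * w₃) (h₄ : ∀ σ, galRingHom σ w₄ = χ₄ σ * w₄)
    (h₅ : ∀ σ, galRingHom σ w₅ = χ₅ σ * w₅) (hζ0 : ζ ≠ 0) (a b c d e : ℕ)
    (hcob : ∀ σ, χ₁ σ ^ a * χ₂ σ ^ b * χ₃ σ ^ c * χ₄ σ ^ d * χ₅ σ ^ e * ζ = galRingHom σ ζ) :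
    ∃ u : F, algebraMap F (AlgebraicClosure F) u =
      w₁ ^ a * w₂ ^ b * w₃ ^ c * w₄ ^ d * w₅ ^ e / ζ := by
  refine WeierstrassCurve.exists_algebraMap_of_forall_galRingHom fun σ ↦ ?_
  rw [map_div₀, map_mul, map_mul, map_mul, map_mul, map_pow, map_pow, map_pow, map_pow, map_pow,
    h₁, h₂, h₃, h₄, h₅, ← hcob σ]
  have hσζ0 : χ₁ σ ^ a * χ₂ σ ^ b * χ₃ σ ^ c * χ₄ σ ^ d * χ₅ σ ^ e * ζ ≠ 0 := by
    rw [hcob σ]; exact (map_ne_zero_iff _ (galRingHom σ).injective).mpr hζ0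
  rw [mul_pow, mul_pow, mul_pow, mul_pow, mul_pow, div_eq_div_iff hσζ0 hζ0]
  ring

/-- **The multiplicative relation attached to a linear relation** (the heart of the `μ₅`-side of the
`5`-descent, on rational points; five-point form). Let `X₁, …, X₅ ∈ E(ℚ) ∖ {O, T}` with
`f_T(X_l) = f_l`, let `Q₀ ∈ E(ℚ)` with `5Q₀ ∉ {O, T}` and `a₀ = f_T(5Q₀)`, and suppose
`e₁X₁ + e₂X₂ + e₃X₃ + e₄X₄ + e₅X₅ = 5Q` with `Q ∈ E(ℚ)`. Then
`f₁^{e₁} ⋯ f₅^{e₅} = u⁵ · a₀^{e₁+⋯+e₅}` for some `u ∈ ℚˣ`.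
[cite: SilvermanAEC2009, Thm. X.1.1(c) (proof) with Exercise 10.1(c)] -/
theorem exists_pow_five_mul_eq₅ {X₁ X₂ X₃ X₄ X₅ : E.toAffine.Point}
    (h₁0 : X₁ ≠ 0) (h₁T : X₁ ≠ T) (h₂0 : X₂ ≠ 0) (h₂T : X₂ ≠ T) (h₃0 : X₃ ≠ 0) (h₃T : X₃ ≠ T)
    (h₄0 : X₄ ≠ 0) (h₄T : X₄ ≠ T) (h₅0 : X₅ ≠ 0) (h₅T : X₅ ≠ T) {f₁ f₂ f₃ f₄ f₅ : ℚ}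
    (hf₁ : E.HasValueAt (kummerFn (13 : ℚ) 14) (toGeom X₁) (algebraMap ℚ (AlgebraicClosure ℚ) f₁))
    (hf₂ : E.HasValueAt (kummerFn (13 : ℚ) 14) (toGeom X₂) (algebraMap ℚ (AlgebraicClosure ℚ) f₂))
    (hf₃ : E.HasValueAt (kummerFn (13 : ℚ) 14) (toGeom X₃) (algebraMap ℚ (AlgebraicClosure ℚ) f₃))
    (hf₄ : E.HasValueAt (kummerFn (13 : ℚ) 14) (toGeom X₄) (algebraMap ℚ (AlgebraicClosure ℚ) f₄))
    (hf₅ : E.HasValueAt (kummerFn (13 : ℚ) 14) (toGeom X₅) (algebraMap ℚ (AlgebraicClosure ℚ) f₅))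
    {Q₀ : E.toAffine.Point} (hQ₀0 : (5 : ℕ) • Q₀ ≠ 0) (hQ₀T : (5 : ℕ) • Q₀ ≠ T)
    {a₀ : AlgebraicClosure ℚ}
    (ha₀ : E.HasValueAt (kummerFn (13 : ℚ) 14) (((5 : ℕ) : ℤ) • toGeom Q₀) a₀)
    (e₁ e₂ e₃ e₄ e₅ : ℕ) {Q : E.toAffine.Point}
    (hrel : e₁ • X₁ + e₂ • X₂ + e₃ • X₃ + e₄ • X₄ + e₅ • X₅ = (5 : ℕ) • Q) :
    ∃ u : ℚ, u ≠ 0 ∧ algebraMap ℚ (AlgebraicClosure ℚ) u ^ 5 * a₀ ^ (e₁ + e₂ + e₃ + e₄ + e₅) =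
      algebraMap ℚ (AlgebraicClosure ℚ) (f₁ ^ e₁ * f₂ ^ e₂ * f₃ ^ e₃ * f₄ ^ e₄ * f₅ ^ e₅) := by
  haveI : Fact (Nat.Prime 5) := ⟨Nat.prime_five⟩
  haveI : NeZero ((5 : ℕ) : ℚ) := ⟨by norm_num⟩
  set ι := algebraMap ℚ (AlgebraicClosure ℚ) with hι
  have hN : ((5 : ℕ) : ℚ) ≠ 0 := natCast_level_ne_zero ℚ 5
  have hT : ((5 : ℕ) : ℤ) • Tbar (13 : ℚ) 14 = 0 := five_zsmul_Tbar 13 14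
  have hTfix : ∀ σ : absoluteGaloisGroup ℚ, σ • Tbar (13 : ℚ) 14 = Tbar (13 : ℚ) 14 :=
    smul_Tbar (13 : ℚ) 14
  have hf0 := kummerFn_ne_zero (13 : ℚ) 14
  have hford := ord_kummerFn (13 : ℚ) 14
  -- the base point `Q₀`
  have hQ₀0' : ((5 : ℕ) : ℤ) • toGeom Q₀ ≠ 0 := by
    rw [natCast_zsmul, ← map_nsmul]
    exact fun h ↦ hQ₀0 (toGeom_injective (h.trans (map_zero _).symm))
  have hQ₀T' : ((5 : ℕ) : ℤ) • toGeom Q₀ ≠ Tbar (13 : ℚ) 14 := by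
    rw [natCast_zsmul, ← map_nsmul, ← toGeom_T]
    exact fun h ↦ hQ₀T (toGeom_injective h)
  have hQ₀fix : ∀ σ : absoluteGaloisGroup ℚ, σ • toGeom Q₀ = toGeom Q₀ := fun σ ↦ smul_toGeom σ Q₀
  -- Kummer element of a rational point `X ∉ {O, T}`
  have key : ∀ {X : E.toAffine.Point}, X ≠ 0 → X ≠ T → ∀ {f : ℚ},
      E.HasValueAt (kummerFn (13 : ℚ) 14) (toGeom X) (ι f) →
      ∃ (R : geomPoints E) (w : AlgebraicClosure ℚ), ((5 : ℕ) : ℤ) • R = toGeom X ∧ w ≠ 0 ∧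
        (∀ σ : absoluteGaloisGroup ℚ, σ • (((5 : ℕ) : ℤ) • R) = ((5 : ℕ) : ℤ) • R) ∧
        (∀ σ : absoluteGaloisGroup ℚ,
          galRingHom σ w = weilPairingFun hN (σ • R - R) (Tbar (13 : ℚ) 14) * w) ∧
        w ^ 5 * a₀ = ι f := by
    intro X hX0 hXT f hf
    obtain ⟨R, hR⟩ := E.zsmul_geomPoints_surjective_holds (n := ((5 : ℕ) : ℤ)) (by norm_num) (toGeom X)
    simp only at hR
    have hR0 : ((5 : ℕ) : ℤ) • R ≠ 0 := by
      rw [hR]; exact fun h ↦ hX0 (toGeom_injective (h.trans (map_zero _).symm))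
    have hRT : ((5 : ℕ) : ℤ) • R ≠ Tbar (13 : ℚ) 14 := by
      rw [hR, ← toGeom_T]; exact fun h ↦ hXT (toGeom_injective h)
    have hRfix : ∀ σ : absoluteGaloisGroup ℚ, σ • (((5 : ℕ) : ℤ) • R) = ((5 : ℕ) : ℤ) • R :=
      fun σ ↦ by rw [hR, smul_toGeom]
    have ha : E.HasValueAt (kummerFn (13 : ℚ) 14) (((5 : ℕ) : ℤ) • R) (ι f) := by rw [hR]; exact hf
    obtain ⟨w, hw0, hσ, hw⟩ := exists_kummerElement (W := E) (N := 5) hT hTfix hf0 hford hR0 hRT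
      hRfix hQ₀0' hQ₀T' hQ₀fix ha ha₀
    exact ⟨R, w, hR, hw0, hRfix, hσ, hw⟩
  obtain ⟨R₁, w₁, hR₁, hw₁0, hR₁fix, hσ₁, hw₁⟩ := key h₁0 h₁T hf₁
  obtain ⟨R₂, w₂, hR₂, hw₂0, hR₂fix, hσ₂, hw₂⟩ := key h₂0 h₂T hf₂
  obtain ⟨R₃, w₃, hR₃, hw₃0, hR₃fix, hσ₃, hw₃⟩ := key h₃0 h₃T hf₃
  obtain ⟨R₄, w₄, hR₄, hw₄0, hR₄fix, hσ₄, hw₄⟩ := key h₄0 h₄T hf₄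
  obtain ⟨R₅, w₅, hR₅, hw₅0, hR₅fix, hσ₅, hw₅⟩ := key h₅0 h₅T hf₅
  -- the `5`-torsion point `R* = Σ e_l R_l - Q`
  set Rs : geomPoints E := e₁ • R₁ + e₂ • R₂ + e₃ • R₃ + e₄ • R₄ + e₅ • R₅ - toGeom Q with hRs
  have hRs5 : ((5 : ℕ) : ℤ) • Rs = 0 := by
    have h := congrArg toGeom hrel
    rw [map_add, map_add, map_add, map_add, map_nsmul, map_nsmul, map_nsmul, map_nsmul, map_nsmul,
      map_nsmul, ← hR₁, ← hR₂, ← hR₃, ← hR₄, ← hR₅] at h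
    rw [hRs, smul_sub, smul_add, smul_add, smul_add, smul_add, smul_comm _ e₁, smul_comm _ e₂,
      smul_comm _ e₃, smul_comm _ e₄, smul_comm _ e₅, h, natCast_zsmul, sub_self]
  set ζ := weilPairingFun hN Rs (Tbar (13 : ℚ) 14) with hζ
  have hζ5 : ζ ^ 5 = 1 := weilPairingFun_pow hN hRs5 hT
  have hζ0 : ζ ≠ 0 := fun h ↦ by
    rw [h, zero_pow (by norm_num)] at hζ5; exact zero_ne_one hζ5
  -- the product cocycle is the coboundary of `ζ`
  have hcob : ∀ σ : absoluteGaloisGroup ℚ,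
      weilPairingFun hN (σ • R₁ - R₁) (Tbar (13 : ℚ) 14) ^ e₁ *
        weilPairingFun hN (σ • R₂ - R₂) (Tbar (13 : ℚ) 14) ^ e₂ *
        weilPairingFun hN (σ • R₃ - R₃) (Tbar (13 : ℚ) 14) ^ e₃ *
        weilPairingFun hN (σ • R₄ - R₄) (Tbar (13 : ℚ) 14) ^ e₄ *
        weilPairingFun hN (σ • R₅ - R₅) (Tbar (13 : ℚ) 14) ^ e₅ * ζ = galRingHom σ ζ := by
    intro σ
    have t₁ : ((5 : ℕ) : ℤ) • (σ • R₁ - R₁) = 0 := by rw [smul_sub, smul_comm, hR₁fix σ, sub_self]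
    have t₂ : ((5 : ℕ) : ℤ) • (σ • R₂ - R₂) = 0 := by rw [smul_sub, smul_comm, hR₂fix σ, sub_self]
    have t₃ : ((5 : ℕ) : ℤ) • (σ • R₃ - R₃) = 0 := by rw [smul_sub, smul_comm, hR₃fix σ, sub_self]
    have t₄ : ((5 : ℕ) : ℤ) • (σ • R₄ - R₄) = 0 := by rw [smul_sub, smul_comm, hR₄fix σ, sub_self]
    have t₅ : ((5 : ℕ) : ℤ) • (σ • R₅ - R₅) = 0 := by rw [smul_sub, smul_comm, hR₅fix σ, sub_self]
    have s₁ : ((5 : ℕ) : ℤ) • (e₁ • (σ • R₁ - R₁)) = 0 := by rw [smul_comm, t₁, smul_zero]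
    have s₂ : ((5 : ℕ) : ℤ) • (e₂ • (σ • R₂ - R₂)) = 0 := by rw [smul_comm, t₂, smul_zero]
    have s₃ : ((5 : ℕ) : ℤ) • (e₃ • (σ • R₃ - R₃)) = 0 := by rw [smul_comm, t₃, smul_zero]
    have s₄ : ((5 : ℕ) : ℤ) • (e₄ • (σ • R₄ - R₄)) = 0 := by rw [smul_comm, t₄, smul_zero]
    have s₅ : ((5 : ℕ) : ℤ) • (e₅ • (σ • R₅ - R₅)) = 0 := by rw [smul_comm, t₅, smul_zero]
    have s₁₂ : ((5 : ℕ) : ℤ) • (e₁ • (σ • R₁ - R₁) + e₂ • (σ • R₂ - R₂)) = 0 := by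
      rw [smul_add, s₁, s₂, add_zero]
    have s₁₂₃ : ((5 : ℕ) : ℤ) • (e₁ • (σ • R₁ - R₁) + e₂ • (σ • R₂ - R₂) + e₃ • (σ • R₃ - R₃)) = 0 := by
      rw [smul_add, s₁₂, s₃, add_zero]
    have s₁₂₃₄ : ((5 : ℕ) : ℤ) • (e₁ • (σ • R₁ - R₁) + e₂ • (σ • R₂ - R₂) + e₃ • (σ • R₃ - R₃) +
        e₄ • (σ • R₄ - R₄)) = 0 := by
      rw [smul_add, s₁₂₃, s₄, add_zero]
    have hσRs : ((5 : ℕ) : ℤ) • (σ • Rs) = 0 := by rw [smul_comm, hRs5, smul_zero]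
    have tdiff : ((5 : ℕ) : ℤ) • (σ • Rs - Rs) = 0 := by rw [smul_sub, hσRs, hRs5, sub_self]
    have hdiff : σ • Rs - Rs = e₁ • (σ • R₁ - R₁) + e₂ • (σ • R₂ - R₂) + e₃ • (σ • R₃ - R₃) +
        e₄ • (σ • R₄ - R₄) + e₅ • (σ • R₅ - R₅) := by
      rw [hRs, smul_sub, smul_add, smul_add, smul_add, smul_add, smul_comm σ e₁ R₁, smul_comm σ e₂ R₂,
        smul_comm σ e₃ R₃, smul_comm σ e₄ R₄, smul_comm σ e₅ R₅, smul_toGeom, nsmul_sub, nsmul_sub,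
        nsmul_sub, nsmul_sub, nsmul_sub]
      abel
    have he : weilPairingFun hN (σ • Rs - Rs) (Tbar (13 : ℚ) 14) =
        weilPairingFun hN (σ • R₁ - R₁) (Tbar (13 : ℚ) 14) ^ e₁ *
          weilPairingFun hN (σ • R₂ - R₂) (Tbar (13 : ℚ) 14) ^ e₂ *
          weilPairingFun hN (σ • R₃ - R₃) (Tbar (13 : ℚ) 14) ^ e₃ *
          weilPairingFun hN (σ • R₄ - R₄) (Tbar (13 : ℚ) 14) ^ e₄ *
          weilPairingFun hN (σ • R₅ - R₅) (Tbar (13 : ℚ) 14) ^ e₅ := by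
      rw [hdiff, weilPairingFun_add_left hN s₁₂₃₄ s₅ hT, weilPairingFun_add_left hN s₁₂₃ s₄ hT,
        weilPairingFun_add_left hN s₁₂ s₃ hT, weilPairingFun_add_left hN s₁ s₂ hT,
        weilPairingFun_nsmul_left hN t₁ hT, weilPairingFun_nsmul_left hN t₂ hT,
        weilPairingFun_nsmul_left hN t₃ hT, weilPairingFun_nsmul_left hN t₄ hT,
        weilPairingFun_nsmul_left hN t₅ hT]
    have hsplit : weilPairingFun hN (σ • Rs) (Tbar (13 : ℚ) 14) =
        weilPairingFun hN (σ • Rs - Rs) (Tbar (13 : ℚ) 14) * ζ := by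
      rw [hζ, ← weilPairingFun_add_left hN tdiff hRs5 hT, sub_add_cancel]
    calc _ = weilPairingFun hN (σ • Rs - Rs) (Tbar (13 : ℚ) 14) * ζ := by rw [he]
      _ = weilPairingFun hN (σ • Rs) (Tbar (13 : ℚ) 14) := hsplit.symm
      _ = weilPairingFun hN (σ • Rs) (σ • Tbar (13 : ℚ) 14) := by rw [hTfix σ]
      _ = σ • ζ := weilPairingFun_smul hN σ hRs5 hT
      _ = galRingHom σ ζ := (galRingHom_apply σ ζ).symm
  obtain ⟨u, hu⟩ := exists_algebraMap_eq_prod₅_div hσ₁ hσ₂ hσ₃ hσ₄ hσ₅ hζ0 e₁ e₂ e₃ e₄ e₅ hcob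
  refine ⟨u, ?_, ?_⟩
  · intro hu0
    rw [hu0, map_zero, eq_comm, div_eq_zero_iff] at hu
    rcases hu with h | h
    · exact (mul_ne_zero (mul_ne_zero (mul_ne_zero (mul_ne_zero (pow_ne_zero _ hw₁0)
        (pow_ne_zero _ hw₂0)) (pow_ne_zero _ hw₃0)) (pow_ne_zero _ hw₄0)) (pow_ne_zero _ hw₅0)) h
    · exact hζ0 h
  · rw [← hι] at hu
    rw [hu, div_pow, hζ5, div_one, map_mul, map_mul, map_mul, map_mul, map_pow, map_pow, map_pow,
      map_pow, map_pow, ← hw₁, ← hw₂, ← hw₃, ← hw₄, ← hw₅]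
    ring

/-- **The three-point case**: `aX₁ + bX₂ + cX₃ = 5Q` with `X_l ∉ {O, T}` gives
`f₁^a f₂^b f₃^c = u⁵ · a₀^{a+b+c}`, `u ∈ ℚˣ`. [cite: SilvermanAEC2009, Thm. X.1.1(c) (proof) with Exercise 10.1(c)] -/
theorem exists_pow_five_mul_eq {X₁ X₂ X₃ : E.toAffine.Point} (h₁0 : X₁ ≠ 0) (h₁T : X₁ ≠ T)
    (h₂0 : X₂ ≠ 0) (h₂T : X₂ ≠ T) (h₃0 : X₃ ≠ 0) (h₃T : X₃ ≠ T) {f₁ f₂ f₃ : ℚ}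
    (hf₁ : E.HasValueAt (kummerFn (13 : ℚ) 14) (toGeom X₁) (algebraMap ℚ (AlgebraicClosure ℚ) f₁))
    (hf₂ : E.HasValueAt (kummerFn (13 : ℚ) 14) (toGeom X₂) (algebraMap ℚ (AlgebraicClosure ℚ) f₂))
    (hf₃ : E.HasValueAt (kummerFn (13 : ℚ) 14) (toGeom X₃) (algebraMap ℚ (AlgebraicClosure ℚ) f₃))
    {Q₀ : E.toAffine.Point} (hQ₀0 : (5 : ℕ) • Q₀ ≠ 0) (hQ₀T : (5 : ℕ) • Q₀ ≠ T)
    {a₀ : AlgebraicClosure ℚ}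
    (ha₀ : E.HasValueAt (kummerFn (13 : ℚ) 14) (((5 : ℕ) : ℤ) • toGeom Q₀) a₀)
    (a b c : ℕ) {Q : E.toAffine.Point} (hrel : a • X₁ + b • X₂ + c • X₃ = (5 : ℕ) • Q) :
    ∃ u : ℚ, u ≠ 0 ∧ algebraMap ℚ (AlgebraicClosure ℚ) u ^ 5 * a₀ ^ (a + b + c) =
      algebraMap ℚ (AlgebraicClosure ℚ) (f₁ ^ a * f₂ ^ b * f₃ ^ c) := by
  have hrel' : a • X₁ + b • X₂ + c • X₃ + 0 • X₁ + 0 • X₁ = (5 : ℕ) • Q := by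
    rw [zero_nsmul, add_zero, add_zero, hrel]
  obtain ⟨u, hu0, hu⟩ := exists_pow_five_mul_eq₅ h₁0 h₁T h₂0 h₂T h₃0 h₃T h₁0 h₁T h₁0 h₁T hf₁ hf₂
    hf₃ hf₁ hf₁ hQ₀0 hQ₀T ha₀ a b c 0 0 hrel'
  refine ⟨u, hu0, ?_⟩
  rw [add_zero, add_zero] at hu
  rw [hu, pow_zero, mul_one, mul_one]

end Kummer

end KubertTate1314Descent

end Literature.NumberTheory.EllipticCurves
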